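import Summits.QuantumFields.YangMills.Theorems.BalabanUVNodesN07NormalisationDbarFrames
import Summits.QuantumFields.YangMills.Theorems.BalabanUVNodesN07DbarFramesBlockConst
import Summits.QuantumFields.YangMills.Theorems.BalabanUVNodesK0Stub1DoubleBarFramesSU
import HarnessLib

/-!
# N07 [B11] (= [15]) Sect. F — CERTIFICATE (C1)∕(C2) OF PLAN RULING A3⁗: **`NrmDbarOfRecord` IS INHABITED** — for the record's `U`, `w`, `h̄` there is an explicit gauge `u` (constant
# `SU(N)`-lifts of the accumulated frames on the block towers of the cells, times `h̄·w`) satisfying MODULE 91's per-site equation; the lifts exist as soon as the symmetric frames of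
# `((U^{w})^{h̄})♮` are special unitary on the `Ω″`-blocks (k0-s1-w1 ★★`suN_vframeU_dbarIterU`, by name), i.e. inside the small-field guard

Cell `pub-ymgap`, seat `pub-ymgap-dag-n07-e` g27 (FAN-OUT §N07 row s3; LANE OWNER of the K0 road), MODULE 92b (INTENT-92, cell bus).  `--kind proof --supports stmt-QuantumFields-20541 --as helper`
(K0⁷); count-neutral; THEOREMS ONLY (0 `def`).  [3] = [Balaban1985Averaging]; [6] = [Balaban1985RegularSpaces]; [15] = [Balaban1985Variational]; [I] = [Balaban1987RG1];
[PropII] = [Balaban1984PropagatorsII].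

WHY (plan g91 RULING A3⁗, cell bus 2026-08-29 08:39:54Z: «ADOPTED as the intended `Nrm` text of record, EFFECTIVE ON THE CERTIFICATE (C1) ∃ u … (C2) its SU(N) instantiation inside the
small-field guard with the frames' special-unitarity supplied BY NAME»).  MODULE 91 normalises S3's gauge by `(V_{j′} y)⁻¹·u↾(y) = (h̄·w)↾(y)` on the cells `y ∈ Λ″_{j′}` of
`D″ = □ ∩ Ω(s)`, `V` the ACCUMULATED symmetric frames ([3] (97)) of `(U^u)♮` — which depend on `u`.  There is no fixed point to solve: by [PropII] (2.4) (`T = ⋃̇_j B^j(Λ_j)`, lit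
✓`Domains.exists_lamSite_iterBlockOf` ∕ ✓`lamSite_iterBlockOf_unique`) every fine site lies under exactly one cell, so a family `sL_{j′}(y) ∈ SU(N)` on the cells defines a fine gauge
`g` CONSTANT on each cell's block tower; by MODULE 92a (`accFrames_gaugeActT_of_under`: [I] (0.6) + UST's effective gauge ★`dbarIterU_gaugeActT_eq_effGauge`) the accumulated frames of
`(X)^{g}`, `X := ((U^{w})^{h̄})♮`, at a cell are `c·Ṽ_{j′}(y)·c⁻¹` with `c = g↾(y)`; choosing `c := Ṽ_{j′}(y)` (its `SU(N)`-lift) gives `V_{j′}(y) = Ṽ_{j′}(y)` and the equation for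
`u := g·(h̄·w)`.  The lift exists when the frames `v(X̿^{(i)})(z)` are special unitary on the blocks `z ∈ Ω″_{i+1}` ((C2): k0-s1-w1 ★★`K0Stub1DoubleBarFramesSU.suN_vframeU_dbarIterU` under
the near-flatness reads of `X` with budgets `8·3800·ℓ²·L^{i+1}·s₀ ≤ 1`, `8ℓ·L^{i+1}·s₀ ≤ θ < δ_N` — the small-field guard of the record).

WHAT IS PROVED (sorry-free; axioms standard; §1–§2 generic `P`, `N ≥ 1`).
* §1 `toUT_mul`, `suN_unitsField_toUField` (lit ✓`Node00.iterBlockOf_embIter_eq` cited by name) · ★ `exists_cellConst_gauge` ([PropII] (2.4): a fine gauge equal to `sL_{j′}(y)` under every cell `y`) · ★★ `clause_of_cellConst` (91's per-site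
  equation for `u := g·gw` from a frame lift `toUT (sL i) = Ṽ i` on the cells) · ★ `exists_frameLift_of_framesSU` (the lift from special-unitarity of the frames on `Ω_{i+1}`).
* §2 ★★★ `NrmDbarOfRecord.exists_of_frameLift` — (C1): `∃ u, NrmDbarOfRecord … s U j idx u A` from the record's `w` (residual, `U^{w}` radial-axial below `j`) and a frame lift on the
  cells of `D″`; ★★★ `NrmDbarOfRecord.exists_of_framesSU` — (C1) from special-unitarity of the frames of `((U^{w})^{h̄})♮` on the `Ω″`-blocks; ★★★ `NrmDbarOfRecord.exists_of_reads` —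
  (C2): the same from the NEAR-FLATNESS READS of `((U^{w})^{h̄})♮` under the `Ω″`-blocks (budgets displayed), special-unitarity discharged by k0-s1-w1's theorem BY NAME.
HONEST SCOPE: a certificate that the normalisation text of record is satisfiable (pure algebra + the landed `SU(N)` frame lemma); the near-flatness reads are HYPOTHESES here (they
are the record's small-field guard, discharged on the K0 road by S1∕S2, not in this file); nothing of [15]∕[3]∕[I] analysis; K0⁷ NOT closed; N07 NOT discharged; one finite 𝕋⁴
programme at fixed ε — the route closes the conditional finite-𝕋⁴ rung `BalabanLadder.UV` ONLY; the YM mass gap (Clay) is NOT proved by any of this; nothing continuum ∕ ℝ⁴ ∕ OS.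
No `def`, no `instance`, no `notation`, no `sorry`.

References: [3] (11) p. 19, (87) p. 31, (92) p. 31, (97)–(100) p. 32, (110) p. 34; [PropII] (2.1)–(2.4) p. 224; [15] (150)–(154) pp. 301–302; [6] (1.29) p. 81; [I] (0.6), (0.9), (0.11) p. 253.
-/

set_option autoImplicit false

noncomputable section

open scoped Matrix.Norms.L2Operator

namespace Summit.QuantumFields.YangMills.BalabanUVNodes.N07NormalisationDbarFramesExists

open Literature.MathematicalPhysics.QuantumFieldTheory.Balaban1983to89
open Literature.MathematicalPhysics.QuantumFieldTheory.Balaban1983to89.Node00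
open T4Continuum (T4Family)
open ExpMeanLog (deltaSU)
open T4AxialGaugeRooted (axialGaugeAt)
open B12GaugeOrbits021 (IsResidual)
open B15Eq177GaugeInvariance (blockLift)
open B16Sect1Backgrounds (toMS)
open B14DomainGeom (Pt)
open B6SectADomainsV1 (Domains)
open B15DeterminingSets (embIter)
open B8Eq131Cubes (tLo tHi ctr)
open GaugeField (gaugeAct)
open B5Eq118OneStroke (iterBlockOf iterBlockOf_succ iterBlockOf_zero)
open B10Eq27TorusAxialLog (unitsField toUField suIncl gaugeActT val_unitsField)
open Summit.QuantumFields.Balaban3D.Carriers (radialContourData)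
open Summit.QuantumFields.YangMills.Theorems.Prop8ChartDoubleBar (vframeU dbarIterU)
open Summit.QuantumFields.YangMills.Theorems.K0Stub1DoubleBarFramesSU (suN_vframeU_dbarIterU)
open Summit.QuantumFields.YangMills.BalabanUVNodes.N07NormalisationDbarFrames (toUT unitsField_toUField_gaugeAct NrmDbarOfRecord)
open Summit.QuantumFields.YangMills.BalabanUVNodes.N07DbarFramesBlockConst (accFrames_gaugeActT_of_under)

variable {P : Params} {N : ℕ} [NeZero N]

/-! ## §1  The cell-constant gauge and the per-site equation (generic domains) -/

/-- `toUT` is multiplicative. [cite: Balaban1985Averaging, (19) p.21 (bookkeeping)] -/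
theorem toUT_mul {i : ℕ} (a b : GaugeTransf P i (SU N)) (y : Site P i) : toUT (fun x => a x * b x) y = toUT a y * toUT b y := by
  show Unitary.toUnits (suIncl (a y * b y)) = _
  rw [map_mul, map_mul]

omit [NeZero N] in
/-- The units reading of an `SU(N)`-valued field is special unitary, bond by bond. [cite: Balaban1985Averaging, (19) p.21 (bookkeeping)] -/
theorem suN_unitsField_toUField {i : ℕ} (V : GaugeField P i (SU N)) (b : PBond P i) :
    ∃ s : Matrix.specialUnitaryGroup (Fin N) ℂ, (s : Matrix (Fin N) (Fin N) ℂ) = ((unitsField (toUField V) b : (Matrix (Fin N) (Fin N) ℂ)ˣ) : Matrix (Fin N) (Fin N) ℂ) :=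
  ⟨V b, by rw [val_unitsField]; rfl⟩

/-- ★ **THE CELL-CONSTANT GAUGE** ([PropII] (2.4): `T = ⋃̇_{j} B^{j}(Λ_j)` — every fine site lies under exactly one cell): for any family `sL_{i}(y)` of group elements on the sites there is
a fine gauge `g` with `g(x) = sL_{j′}(y)` for every fine `x` under every cell `y ∈ Λ_{j′}`. [cite: Balaban1984PropagatorsII, (2.4) p.224] -/
theorem exists_cellConst_gauge {G : Type*} (D : Domains P) (sL : (i : ℕ) → Site P i → G) :
    ∃ g : Site P 0 → G, ∀ (i : ℕ) (y : Site P i), D.LamSite i y → ∀ x : Site P 0, iterBlockOf i x = y → g x = sL i y := by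
  classical
  refine ⟨fun x => sL (Classical.choose (D.exists_lamSite_iterBlockOf x)) (iterBlockOf (Classical.choose (D.exists_lamSite_iterBlockOf x)) x), ?_⟩
  intro i y hy x hx
  subst hx
  have key : ∀ {a b : ℕ}, a = b → sL a (iterBlockOf a x) = sL b (iterBlockOf b x) := by
    rintro a _ rfl
    rfl
  exact key (D.lamSite_iterBlockOf_unique (Classical.choose_spec (D.exists_lamSite_iterBlockOf x)).2 hy)

/-- ★★ **THE PER-SITE EQUATION FROM A FRAME LIFT**: let `X := (U^{gw})♮`, `Ṽ` its accumulated symmetric frames (`Ṽ 0 = 1`, `Ṽ (i+1) y = Ṽ i (emb y)·vframeU (X̿^{(i)}) y`), `sL` an `SU(N)`-lift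
of `Ṽ` on the cells of `D` (`toUT (sL i) y = Ṽ i y`), and `g` a fine gauge with `g ≡ sL_{j′}(y)` under every cell `y`.  Then for `u := g·gw` and EVERY family `V` of accumulated frames of
`(U^{u})♮`:  `V_{j′}(y)⁻¹ · u↾(y) = gw↾(y)` at every cell `y ∈ Λ_{j′}` (MODULE 92a: `V_{j′}(y) = c·Ṽ_{j′}(y)·c⁻¹`, `c = Ṽ_{j′}(y)`).
[cite: Balaban1985Averaging, (87) p.31, (92) p.31, (97) p.32; Balaban1987RG1, (0.6) p.253; Balaban1985RegularSpaces, (1.29) p.81] -/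
theorem clause_of_cellConst (D : Domains P) (U : GaugeField P 0 (SU N)) (gw g : GaugeTransf P 0 (SU N))
    (Vt : (i : ℕ) → Site P i → (Matrix (Fin N) (Fin N) ℂ)ˣ) (hVt0 : ∀ x, Vt 0 x = 1)
    (hVts : ∀ (i : ℕ) (y : Site P (i + 1)), Vt (i + 1) y = Vt i (emb y) * vframeU (dbarIterU i (unitsField (toUField (gaugeAct gw U)))) y)
    (sL : (i : ℕ) → Site P i → SU N) (hsL : ∀ (i : ℕ) (y : Site P i), D.LamSite i y → toUT (sL i) y = Vt i y)
    (hg : ∀ (i : ℕ) (y : Site P i), D.LamSite i y → ∀ x : Site P 0, iterBlockOf i x = y → g x = sL i y)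
    (V : (i : ℕ) → Site P i → (Matrix (Fin N) (Fin N) ℂ)ˣ) (hV0 : ∀ x, V 0 x = 1)
    (hVs : ∀ (i : ℕ) (y : Site P (i + 1)), V (i + 1) y = V i (emb y) * vframeU (dbarIterU i (unitsField (toUField (gaugeAct (fun x => g x * gw x) U)))) y) :
    ∀ (j' : ℕ) (y : Site P j'), D.LamSite j' y → (V j' y)⁻¹ * toUT (toMS (fun x => g x * gw x) j') y = toUT (toMS gw j') y := by
  intro j' y hy
  have hj' : j' ≤ P.m + P.K := (D.le_of_lamSite hy).trans D.hk
  set W := unitsField (toUField (gaugeAct gw U)) with hW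
  have hWg : unitsField (toUField (gaugeAct (fun x => g x * gw x) U)) = gaugeActT (toUT g) W := by
    rw [← T3UnitLawGaugeInvariance.gaugeAct_gaugeAct, unitsField_toUField_gaugeAct]
  -- the effective gauge of `toUT g` down the double-bar tower of `W`
  let κ : (i : ℕ) → GaugeTransf P i (Matrix (Fin N) (Fin N) ℂ)ˣ :=
    Nat.rec (toUT g) fun i κi => fun y' => (vframeU (gaugeActT κi (dbarIterU i W)) y')⁻¹ * κi (emb y') * vframeU (dbarIterU i W) y'
  have hconst : ∀ x : Site P 0, iterBlockOf j' x = y → toUT g x = toUT (sL j') y := fun x hx => by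
    show Unitary.toUnits (suIncl (g x)) = Unitary.toUnits (suIncl (sL j' y))
    rw [hg j' y hy x hx]
  have hVs' : ∀ (i : ℕ) (y : Site P (i + 1)), V (i + 1) y = V i (emb y) * vframeU (dbarIterU i (gaugeActT (toUT g) W)) y := fun i y => by
    rw [hVs, hWg]
  have hV := accFrames_gaugeActT_of_under W (toUT g) κ rfl (fun _ _ => rfl) Vt hVt0 hVts V hV0 hVs' (toUT (sL j') y) j' hj' y hconst
  rw [hV, ← hsL j' y hy, show toUT (toMS (fun x => g x * gw x) j') y = toUT (fun x => g x * gw x) (embIter j' y) from rfl, toUT_mul,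
    hconst (embIter j' y) (iterBlockOf_embIter_eq hj' y)]
  show (toUT (sL j') y * toUT (sL j') y * (toUT (sL j') y)⁻¹)⁻¹ * (toUT (sL j') y * toUT gw (embIter j' y)) = toUT gw (embIter j' y)
  group

/-- ★ **THE FRAME LIFT FROM SPECIAL-UNITARITY ON THE `Ω`-BLOCKS**: if the symmetric frames `vframeU (X̿^{(i)}) z` are special unitary at every block `z ∈ Ω_{i+1}^{(i+1)}`, `i+1 ≤ k`, then the
accumulated frames `Ṽ` admit an `SU(N)`-lift `sL` with `toUT (sL i) y = Ṽ i y` at every `y ∈ Ω_i^{(i)}`, `i ≤ k` (the centre chain under `y` stays in the `Ω`'s by nesting) — in particular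
on the cells. [cite: Balaban1985Averaging, (97) p.32; Balaban1987RG1, (0.9) p.253; Balaban1984PropagatorsII, (2.1) p.224] -/
theorem exists_frameLift_of_framesSU (D : Domains P) (X : GaugeField P 0 (Matrix (Fin N) (Fin N) ℂ)ˣ)
    (Vt : (i : ℕ) → Site P i → (Matrix (Fin N) (Fin N) ℂ)ˣ) (hVt0 : ∀ x, Vt 0 x = 1)
    (hVts : ∀ (i : ℕ) (y : Site P (i + 1)), Vt (i + 1) y = Vt i (emb y) * vframeU (dbarIterU i X) y)
    (hsu : ∀ (i : ℕ) (z : Site P (i + 1)), i + 1 ≤ D.k → z ∈ D.Om (i + 1) →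
      ∃ s : Matrix.specialUnitaryGroup (Fin N) ℂ, (s : Matrix (Fin N) (Fin N) ℂ) = ((vframeU (dbarIterU i X) z : (Matrix (Fin N) (Fin N) ℂ)ˣ) : Matrix (Fin N) (Fin N) ℂ)) :
    ∃ sL : (i : ℕ) → Site P i → SU N, ∀ (i : ℕ) (y : Site P i), i ≤ D.k → y ∈ D.Om i → toUT (sL i) y = Vt i y := by
  classical
  let sL : (i : ℕ) → Site P i → SU N := Nat.rec (fun _ => 1) fun i sLi => fun y =>
    sLi (emb y) * (if h : ∃ s : Matrix.specialUnitaryGroup (Fin N) ℂ, (s : Matrix (Fin N) (Fin N) ℂ) = ((vframeU (dbarIterU i X) y : (Matrix (Fin N) (Fin N) ℂ)ˣ) : Matrix (Fin N) (Fin N) ℂ)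
      then Classical.choose h else 1)
  refine ⟨sL, ?_⟩
  intro i
  induction i with
  | zero => intro y _ _; rw [hVt0]; exact map_one (Unitary.toUnits.comp suIncl)
  | succ i ih =>
    intro y hi hy
    have hi' : i + 1 ≤ P.m + P.K := hi.trans D.hk
    have hemb : emb y ∈ D.Om i := D.nested (emb y) (by rw [Site.blockOf_emb hi']; exact hy)
    have h := hsu i y hi hy
    rw [hVts, ← ih (emb y) (by omega) hemb]
    show Unitary.toUnits (suIncl (sL i (emb y) * (if h : ∃ s : Matrix.specialUnitaryGroup (Fin N) ℂ, (s : Matrix (Fin N) (Fin N) ℂ) =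
        ((vframeU (dbarIterU i X) y : (Matrix (Fin N) (Fin N) ℂ)ˣ) : Matrix (Fin N) (Fin N) ℂ) then Classical.choose h else 1))) = _
    rw [dif_pos h, map_mul, map_mul]
    congr 1
    exact Units.ext (Classical.choose_spec h)

/-! ## §2  The certificate at the record -/

section Record

variable {F : T4Family}

/-- ★★★ **(C1) `NrmDbarOfRecord` IS INHABITED, FROM A FRAME LIFT ON THE CELLS**: for the datum `(j, idx)`, the minimiser `U`, a residual `w` of level `j` with `U^{w}` radial-axial below
`j`, `h̄ :=` the block lift of the top axial gauge of `M^{j}(U^{w})` on print's window, `X := ((U^{w})^{h̄})♮ = (U^{h̄·w})♮`, `Ṽ` the accumulated frames of `X`, and an `SU(N)`-lift `sL` of `Ṽ`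
on the cells of `D″ = □ ∩ Ω(s)`:  there is a gauge `u` (explicitly `u = g·(h̄·w)`, `g` the cell-constant gauge of `sL`) with `NrmDbarOfRecord … s U j idx u A`.
[cite: Balaban1985Averaging, (87) p.31, (92) p.31, (97) p.32; Balaban1985Variational, (150)–(154) pp.301–302; Balaban1985RegularSpaces, (1.29) p.81; Balaban1987RG1, (0.6), (0.11) p.253] -/
theorem NrmDbarOfRecord.exists_of_frameLift {Mc ρ : ℕ} {ν : Stage7Numerics} {M : ℕ} {g : ℕ → ℝ} {K k : ℕ} (s : SeqOfRecord F ν M g K k)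
    (U : GaugeField (F.P K) 0 (SU N)) (j : ℕ) (idx : Pt (F.P K).d) (A : PBond (F.P K) 0 → MatA N) (hk : j ≤ (F.P K).m + (F.P K).K)
    (w : GaugeTransf (F.P K) 0 (SU N)) (hw : IsResidual j w)
    (hax : ∀ i < j, AxialGauge (radialContourData (F.P K) i (SU N)) (Averaging.iter (avOfRecord F N K) i (gaugeAct w U)))
    (Vt : (i : ℕ) → Site (F.P K) i → (Matrix (Fin N) (Fin N) ℂ)ˣ) (hVt0 : ∀ x, Vt 0 x = 1)
    (hVts : ∀ (i : ℕ) (y : Site (F.P K) (i + 1)), Vt (i + 1) y = Vt i (emb y) *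
      vframeU (dbarIterU i (unitsField (toUField (gaugeAct (fun x => blockLift j (axialGaugeAt (Averaging.iter (avOfRecord F N K) j (gaugeAct w U))
        (tLo (cornerP (F.P K) Mc ρ idx) ρ) (tHi (cornerP (F.P K) Mc ρ idx) (sideP (F.P K) Mc ρ) ρ) (ctr (cornerP (F.P K) Mc ρ idx) (sideP (F.P K) Mc ρ))) x * w x) U)))) y)
    (sL : (i : ℕ) → Site (F.P K) i → SU N)
    (hsL : ∀ (i : ℕ) (y : Site (F.P K) i),
      (domainsMeet (cubeDomains (F.P K) (cornerP (F.P K) Mc ρ idx) (sideP (F.P K) Mc ρ) ρ j hk) (domainsOfSeq s.Ω j hk)).LamSite i y → toUT (sL i) y = Vt i y) :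
    ∃ u : GaugeTransf (F.P K) 0 (SU N), NrmDbarOfRecord F N Mc ρ ν M g K k s U j idx u A := by
  obtain ⟨g', hg'⟩ := exists_cellConst_gauge (domainsMeet (cubeDomains (F.P K) (cornerP (F.P K) Mc ρ idx) (sideP (F.P K) Mc ρ) ρ j hk) (domainsOfSeq s.Ω j hk)) sL
  refine ⟨fun x => g' x * (blockLift j (axialGaugeAt (Averaging.iter (avOfRecord F N K) j (gaugeAct w U))
      (tLo (cornerP (F.P K) Mc ρ idx) ρ) (tHi (cornerP (F.P K) Mc ρ idx) (sideP (F.P K) Mc ρ) ρ) (ctr (cornerP (F.P K) Mc ρ idx) (sideP (F.P K) Mc ρ))) x * w x),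
    w, hw, hax, ?_⟩
  intro hk' V hV0 hVs j' hj' y hy
  exact clause_of_cellConst (domainsMeet (cubeDomains (F.P K) (cornerP (F.P K) Mc ρ idx) (sideP (F.P K) Mc ρ) ρ j hk) (domainsOfSeq s.Ω j hk)) U _ g' Vt hVt0 hVts sL hsL hg'
    V hV0 hVs j' y hy

/-- ★★★ **(C1) FROM SPECIAL-UNITARITY OF THE FRAMES ON THE `Ω″`-BLOCKS**: as `exists_of_frameLift`, the lift supplied by `exists_frameLift_of_framesSU` from «`vframeU (X̿^{(i)}) z ∈ SU(N)` at every
`z ∈ Ω″_{i+1}`, `i+1 ≤ k″`», `X = (U^{h̄·w})♮`, `Ṽ` ANY family of accumulated frames of `X`. [cite: Balaban1985Averaging, (97) p.32; Balaban1987RG1, (0.9), (0.11) p.253; Balaban1985Variational, (150)–(154) pp.301–302] -/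
theorem NrmDbarOfRecord.exists_of_framesSU {Mc ρ : ℕ} {ν : Stage7Numerics} {M : ℕ} {g : ℕ → ℝ} {K k : ℕ} (s : SeqOfRecord F ν M g K k)
    (U : GaugeField (F.P K) 0 (SU N)) (j : ℕ) (idx : Pt (F.P K).d) (A : PBond (F.P K) 0 → MatA N) (hk : j ≤ (F.P K).m + (F.P K).K)
    (w : GaugeTransf (F.P K) 0 (SU N)) (hw : IsResidual j w)
    (hax : ∀ i < j, AxialGauge (radialContourData (F.P K) i (SU N)) (Averaging.iter (avOfRecord F N K) i (gaugeAct w U)))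
    (Vt : (i : ℕ) → Site (F.P K) i → (Matrix (Fin N) (Fin N) ℂ)ˣ) (hVt0 : ∀ x, Vt 0 x = 1)
    (hVts : ∀ (i : ℕ) (y : Site (F.P K) (i + 1)), Vt (i + 1) y = Vt i (emb y) *
      vframeU (dbarIterU i (unitsField (toUField (gaugeAct (fun x => blockLift j (axialGaugeAt (Averaging.iter (avOfRecord F N K) j (gaugeAct w U))
        (tLo (cornerP (F.P K) Mc ρ idx) ρ) (tHi (cornerP (F.P K) Mc ρ idx) (sideP (F.P K) Mc ρ) ρ) (ctr (cornerP (F.P K) Mc ρ idx) (sideP (F.P K) Mc ρ))) x * w x) U)))) y)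
    (hsu : ∀ (i : ℕ) (z : Site (F.P K) (i + 1)),
      i + 1 ≤ (domainsMeet (cubeDomains (F.P K) (cornerP (F.P K) Mc ρ idx) (sideP (F.P K) Mc ρ) ρ j hk) (domainsOfSeq s.Ω j hk)).k →
      z ∈ (domainsMeet (cubeDomains (F.P K) (cornerP (F.P K) Mc ρ idx) (sideP (F.P K) Mc ρ) ρ j hk) (domainsOfSeq s.Ω j hk)).Om (i + 1) →
      ∃ s' : Matrix.specialUnitaryGroup (Fin N) ℂ, (s' : Matrix (Fin N) (Fin N) ℂ) =
        ((vframeU (dbarIterU i (unitsField (toUField (gaugeAct (fun x => blockLift j (axialGaugeAt (Averaging.iter (avOfRecord F N K) j (gaugeAct w U))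
          (tLo (cornerP (F.P K) Mc ρ idx) ρ) (tHi (cornerP (F.P K) Mc ρ idx) (sideP (F.P K) Mc ρ) ρ) (ctr (cornerP (F.P K) Mc ρ idx) (sideP (F.P K) Mc ρ))) x * w x) U)))) z :
          (Matrix (Fin N) (Fin N) ℂ)ˣ) : Matrix (Fin N) (Fin N) ℂ)) :
    ∃ u : GaugeTransf (F.P K) 0 (SU N), NrmDbarOfRecord F N Mc ρ ν M g K k s U j idx u A := by
  obtain ⟨sL, hsL⟩ := exists_frameLift_of_framesSU _ _ Vt hVt0 hVts hsu
  exact NrmDbarOfRecord.exists_of_frameLift s U j idx A hk w hw hax Vt hVt0 hVts sL fun i y hy => hsL i y (Domains.le_of_lamSite _ hy) hy.1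

/-- ★★★ **(C2) `NrmDbarOfRecord` IS INHABITED INSIDE THE SMALL-FIELD GUARD**: as `exists_of_framesSU`, the special-unitarity of the frames DISCHARGED by k0-s1-w1's
★★`K0Stub1DoubleBarFramesSU.suN_vframeU_dbarIterU` from the near-flatness reads of `X = (U^{h̄·w})♮` on the fine bonds under every block `z ∈ Ω″_{i+1}` (`‖X(b) − 1‖ ≤ s₀`) with the
budgets `8·3800·ℓ²·L^{i+1}·s₀ ≤ 1` and `8ℓ·L^{i+1}·s₀ ≤ θ < δ_N` (`ℓ = (d+2)L`; `X` is `SU(N)`-valued by construction).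
[cite: Balaban1987RG1, (0.9), (0.11) p.253; Balaban1985Averaging, (97) p.32, (110) p.34, Prop. 4 (134)–(135) p.38; Balaban1985Variational, (150)–(154) pp.301–302] -/
theorem NrmDbarOfRecord.exists_of_reads {Mc ρ : ℕ} {ν : Stage7Numerics} {M : ℕ} {g : ℕ → ℝ} {K k : ℕ} (s : SeqOfRecord F ν M g K k)
    (U : GaugeField (F.P K) 0 (SU N)) (j : ℕ) (idx : Pt (F.P K).d) (A : PBond (F.P K) 0 → MatA N) (hk : j ≤ (F.P K).m + (F.P K).K)
    (w : GaugeTransf (F.P K) 0 (SU N)) (hw : IsResidual j w)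
    (hax : ∀ i < j, AxialGauge (radialContourData (F.P K) i (SU N)) (Averaging.iter (avOfRecord F N K) i (gaugeAct w U)))
    (Vt : (i : ℕ) → Site (F.P K) i → (Matrix (Fin N) (Fin N) ℂ)ˣ) (hVt0 : ∀ x, Vt 0 x = 1)
    (hVts : ∀ (i : ℕ) (y : Site (F.P K) (i + 1)), Vt (i + 1) y = Vt i (emb y) *
      vframeU (dbarIterU i (unitsField (toUField (gaugeAct (fun x => blockLift j (axialGaugeAt (Averaging.iter (avOfRecord F N K) j (gaugeAct w U))
        (tLo (cornerP (F.P K) Mc ρ idx) ρ) (tHi (cornerP (F.P K) Mc ρ idx) (sideP (F.P K) Mc ρ) ρ) (ctr (cornerP (F.P K) Mc ρ idx) (sideP (F.P K) Mc ρ))) x * w x) U)))) y)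
    {s₀ θ : ℝ} (hs₀ : 0 ≤ s₀) (hθ : θ < deltaSU (Fin N))
    (hbudget : ∀ i : ℕ, i + 1 ≤ (domainsMeet (cubeDomains (F.P K) (cornerP (F.P K) Mc ρ idx) (sideP (F.P K) Mc ρ) ρ j hk) (domainsOfSeq s.Ω j hk)).k →
      8 * 3800 * ((((F.P K).d + 2) * (F.P K).L : ℕ) : ℝ) ^ 2 * ((F.P K).L : ℝ) ^ (i + 1) * s₀ ≤ 1)
    (hguard : ∀ i : ℕ, i + 1 ≤ (domainsMeet (cubeDomains (F.P K) (cornerP (F.P K) Mc ρ idx) (sideP (F.P K) Mc ρ) ρ j hk) (domainsOfSeq s.Ω j hk)).k →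
      8 * ((((F.P K).d + 2) * (F.P K).L : ℕ) : ℝ) * ((F.P K).L : ℝ) ^ (i + 1) * s₀ ≤ θ)
    (hreads : ∀ (i : ℕ) (z : Site (F.P K) (i + 1)),
      i + 1 ≤ (domainsMeet (cubeDomains (F.P K) (cornerP (F.P K) Mc ρ idx) (sideP (F.P K) Mc ρ) ρ j hk) (domainsOfSeq s.Ω j hk)).k →
      z ∈ (domainsMeet (cubeDomains (F.P K) (cornerP (F.P K) Mc ρ idx) (sideP (F.P K) Mc ρ) ρ j hk) (domainsOfSeq s.Ω j hk)).Om (i + 1) →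
      ∀ b : PBond (F.P K) 0, iterBlockOf (i + 1) b.src = z → iterBlockOf (i + 1) b.tgt = z →
        ‖((unitsField (toUField (gaugeAct (fun x => blockLift j (axialGaugeAt (Averaging.iter (avOfRecord F N K) j (gaugeAct w U))
          (tLo (cornerP (F.P K) Mc ρ idx) ρ) (tHi (cornerP (F.P K) Mc ρ idx) (sideP (F.P K) Mc ρ) ρ) (ctr (cornerP (F.P K) Mc ρ idx) (sideP (F.P K) Mc ρ))) x * w x) U)) b :
          (Matrix (Fin N) (Fin N) ℂ)ˣ) : Matrix (Fin N) (Fin N) ℂ) - 1‖ ≤ s₀) :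
    ∃ u : GaugeTransf (F.P K) 0 (SU N), NrmDbarOfRecord F N Mc ρ ν M g K k s U j idx u A := by
  refine NrmDbarOfRecord.exists_of_framesSU s U j idx A hk w hw hax Vt hVt0 hVts fun i z hi hz => ?_
  have hi' : i + 1 ≤ (F.P K).m + (F.P K).K := hi.trans (Domains.hk _)
  exact suN_vframeU_dbarIterU hi' z _ hs₀ hθ (hbudget i hi) (hguard i hi) (hreads i z hi hz) fun b _ _ => suN_unitsField_toUField _ b

end Record

end Summit.QuantumFields.YangMills.BalabanUVNodes.N07NormalisationDbarFramesExists

end
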